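import Literature.NumberTheory.EllipticCurves.TateModuleWildKernelProofs
import Literature.NumberTheory.EllipticCurves.QuadraticTwistTateFormProofs
import HarnessLib

/-!
# The tameness of `V_ℓ E` at a place `v ∤ 2` does not depend on `ℓ` (Silverman *ATAEC*
# Thm. IV.10.2(b),(c) and Prop. IV.10.3; Serre–Tate 1968), proofs

`Proofs` file (theorems only: no definitions, no named facts, no instances) in topic
`NumberTheory/EllipticCurves`, landed by the tenured seat of the named fact
`Literature.NumberTheory.Automorphic.BCDT.CDT_theorem_7_2_4` (Conrad–Diamond–Taylor 1999,
Thm. 7.2.4).  One-screen assembly of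

* `TateModuleWildKernelProofs` (same seat): at the places of potentially good reduction the kernel
  of the inertia action on `T_ℓ E` does not depend on `ℓ` (Serre–Tate; criterion of
  Néron–Ogg–Shafarevich over the fixed field of `⟨τ⟩`), unconditionally at the places `v ∤ 2` of
  integral `j` (potential good reduction over `F ⊇ K(E[4])`, `PotentialGoodReductionOddProofs`):
  `isTameAt_rationalTate_iff_of_valuation_j_le_one_of_notMem_two`;
* `QuadraticTwistTateFormProofs` (bsd.S15 seat): at the places `v ∤ 2` with `ord_v(j) < 0`,
  `V_ℓ E` is tame for every `ℓ` (`isTameAt_rationalTate_of_one_lt_valuation_j`: a quadratic twist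
  has multiplicative reduction, `[K(√d):K] ≤ 2 < p`),

into the statement consumed by the zero form of Ogg's formula at `p = 3`
(`CDTTheorem712OggThreeTwoProofs`): **for every elliptic curve over a number field, every place
`v ∤ 2` and primes `ℓ, ℓ' ∤ v`, `V_ℓ E` is tame at `𝔓 ∣ v` iff `V_{ℓ'} E` is; equivalently
`Sw_𝔓(V_ℓ E) = 0 ↔ Sw_𝔓(V_{ℓ'} E) = 0`** — the part of Thm. IV.10.2(c) (independence of `ℓ`, not
proved in the book, PDF p. 362) that the zero form needs.

## References

* J. H. Silverman, *Advanced Topics in the Arithmetic of Elliptic Curves*, GTM 151 (1994), §IV.10,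
  Thm. 10.2(b),(c), Prop. 10.3 and their proofs (PDF pp. 358–362). [SilvermanATAEC1994]
* J.-P. Serre, J. Tate, *Good reduction of abelian varieties*, Ann. of Math. 88 (1968), §§1–3
  (not held; cited for attribution). [SerreTate1968]

## Design

Theorems only; `noncomputable section`; universe `u`; namespace `WeierstrassCurve` (deliberate
dot-notation extensions next to `isTameAt_rationalTate_iff_of_potentiallyGood`).  Axioms of every
theorem: `propext`, `Classical.choice`, `Quot.sound`.
-/

noncomputable section

open scoped Classical NumberField
open Field IsDedekindDomain

universe u

namespace WeierstrassCurve

open Literature.NumberTheory.EllipticCurves Literature.NumberTheory.GaloisRepresentations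
  IsDedekindDomain.HeightOneSpectrum

variable {K : Type u} [Field K] [NumberField K] (W : WeierstrassCurve K)

/-- **At every place `v ∤ 2` — in particular at residue characteristic `3` — `V_ℓ E` is tame at
`𝔓 ∣ v` iff `V_{ℓ'} E` is** (`v ∤ ℓ, ℓ'`), for every elliptic curve over a number field,
unconditionally.  At the places of integral `j` this is
`isTameAt_rationalTate_iff_of_valuation_j_le_one_of_notMem_two` (potential good reduction over
`F ⊇ K(E[4])` and the criterion of Néron–Ogg–Shafarevich); at the places with `ord_v(j) < 0` both
sides hold (`isTameAt_rationalTate_of_one_lt_valuation_j`, `QuadraticTwistTateFormProofs`: a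
quadratic twist has multiplicative reduction, `[K(√d):K] ≤ 2 < p`).  Silverman *ATAEC*
Thm. IV.10.2(b),(c) and Prop. IV.10.3 (PDF pp. 358–362); Serre–Tate §2–3.
[cite: SilvermanATAEC1994, Thm. IV.10.2(b),(c) and Prop. IV.10.3 (PDF pp. 358–362)]
[cite: SerreTate1968, §§2–3] -/
theorem isTameAt_rationalTate_iff_of_notMem_two [W.IsElliptic]
    {v : HeightOneSpectrum (𝓞 K)} (h2 : (2 : 𝓞 K) ∉ v.asIdeal)
    {𝔓 : Ideal (absIntegers (𝓞 K) K)} (h𝔓 : 𝔓 ∈ v.primesAbove)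
    (ℓ : ℕ) [Fact ℓ.Prime] (hℓ : (ℓ : 𝓞 K) ∉ v.asIdeal)
    (h : Continuous fun x : absoluteGaloisGroup K × RationalTateModule (geomPoints W) ℓ ↦
      rationalTateRepresentation (absoluteGaloisGroup K) (geomPoints W) ℓ x.1 x.2)
    (ℓ' : ℕ) [Fact ℓ'.Prime] (hℓ' : (ℓ' : 𝓞 K) ∉ v.asIdeal)
    (h' : Continuous fun x : absoluteGaloisGroup K × RationalTateModule (geomPoints W) ℓ' ↦
      rationalTateRepresentation (absoluteGaloisGroup K) (geomPoints W) ℓ' x.1 x.2) :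
    (rationalTateGaloisRepOf (geomPoints W) ℓ h).IsTameAt (𝓞 K) 𝔓 ↔
      (rationalTateGaloisRepOf (geomPoints W) ℓ' h').IsTameAt (𝓞 K) 𝔓 := by
  by_cases hj : v.valuation K W.j ≤ 1
  · exact W.isTameAt_rationalTate_iff_of_valuation_j_le_one_of_notMem_two hj h2 h𝔓 ℓ hℓ h ℓ' hℓ' h'
  · have hj' : 1 < v.valuation K W.j := not_le.mp hj
    have h2' : ringChar (𝓞 K ⧸ v.asIdeal) ≠ 2 :=
      v.ringChar_ne_of_natCast_notMem (p := 2) (by exact_mod_cast h2)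
    exact ⟨fun _ ↦ W.isTameAt_rationalTate_of_one_lt_valuation_j ℓ' h' hℓ' h2' hj' h𝔓,
      fun _ ↦ W.isTameAt_rationalTate_of_one_lt_valuation_j ℓ h hℓ h2' hj' h𝔓⟩

/-- **At every place `v ∤ 2`, `Sw_𝔓(V_ℓ E) = 0 ↔ Sw_𝔓(V_{ℓ'} E) = 0`** (`v ∤ ℓ, ℓ'`),
unconditionally: `isTameAt_rationalTate_iff_of_notMem_two` with
`swanConductorAt_rationalTate_eq_zero_iff_isTameAt`.  This is the part of Silverman *ATAEC*
Thm. IV.10.2(c) (independence of `ℓ`, cited out in the book, PDF p. 362) that the zero form of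
Ogg's formula at `p = 3` needs: with it, Ogg's formula for `V₂ E` at the additive places of residue
characteristic `3` — the statement the book proves on pp. 366–371 with `L = K(E[2])` — gives
`δ_v(E) = 0 ↔ V_ℓ E` tame for every `ℓ ≠ 3` (`CDTTheorem712OggThreeTwoProofs`).
[cite: SilvermanATAEC1994, Thm. IV.10.2(c) (PDF pp. 358, 362) and proof of Thm. IV.11.1 for p = 3 (pp. 366–371)] -/
theorem swanConductorAt_rationalTate_eq_zero_iff_of_notMem_two [W.IsElliptic]
    {v : HeightOneSpectrum (𝓞 K)} (h2 : (2 : 𝓞 K) ∉ v.asIdeal)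
    {𝔓 : Ideal (absIntegers (𝓞 K) K)} (h𝔓 : 𝔓 ∈ v.primesAbove)
    (ℓ : ℕ) [Fact ℓ.Prime] (hℓ : (ℓ : 𝓞 K) ∉ v.asIdeal)
    (h : Continuous fun x : absoluteGaloisGroup K × RationalTateModule (geomPoints W) ℓ ↦
      rationalTateRepresentation (absoluteGaloisGroup K) (geomPoints W) ℓ x.1 x.2)
    (ℓ' : ℕ) [Fact ℓ'.Prime] (hℓ' : (ℓ' : 𝓞 K) ∉ v.asIdeal)
    (h' : Continuous fun x : absoluteGaloisGroup K × RationalTateModule (geomPoints W) ℓ' ↦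
      rationalTateRepresentation (absoluteGaloisGroup K) (geomPoints W) ℓ' x.1 x.2) :
    (rationalTateGaloisRepOf (geomPoints W) ℓ h).swanConductorAt (𝓞 K) 𝔓 = 0 ↔
      (rationalTateGaloisRepOf (geomPoints W) ℓ' h').swanConductorAt (𝓞 K) 𝔓 = 0 := by
  rw [W.swanConductorAt_rationalTate_eq_zero_iff_isTameAt ℓ h hℓ h𝔓,
    W.swanConductorAt_rationalTate_eq_zero_iff_isTameAt ℓ' h' hℓ' h𝔓]
  exact W.isTameAt_rationalTate_iff_of_notMem_two h2 h𝔓 ℓ hℓ h ℓ' hℓ' h'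


end WeierstrassCurve

end
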